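import Mathlib.LinearAlgebra.UnitaryGroup
import Mathlib.Topology.Instances.Matrix
import Mathlib.Analysis.Complex.Basic

/-!
# Tier-5 support (seat p3, cell pub-hodge-repro2) — the unitary group `U(n)` is compact
(B1 Lemma B1.2.3)

Behind route/T4-B1-p3.md v7 (sub-claim B1, FINAL) l. 39 «at each real place τ, U(V_τ) is the
isometry group of the standard positive definite form on ℂ³, i.e. U(3), compact
[P, Lemma B1.2.3]» and l. 14 «at every real place τ of F⁺, U(V ⊗_{A_{F⁺},τ} ℝ) ≅ U(3) is
compact»: Mathlib's `Matrix.unitaryGroup n ℂ` (the isometry group of the standard form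
`x₁ȳ₁ + ⋯ + xₙȳₙ`) is a compact subset of `Matrix n n ℂ`, hence a compact topological group.

The proof is the classical one: `U(n)` is CLOSED (the zero set of `U ↦ Uᴴ U − 1` and
`U ↦ U Uᴴ − 1`, `isClosed_unitaryGroup`) and BOUNDED — every entry of a unitary matrix has
`‖U i j‖ ≤ 1` because the columns are unit vectors, `∑ᵢ ‖U i j‖² = (Uᴴ U) j j = 1`
(`sum_norm_sq_col`, `norm_entry_le_one`) — so it sits inside the box `∏ᵢⱼ {|z| ≤ 1}`, compact by
Tychonoff (`isCompact_univ_pi`, `isCompact_closedBall`), and a closed subset of a compact set is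
compact (`isCompact_unitaryGroup`, `compactSpace_unitaryGroup`); `U(3)` is the case `n = Fin 3`
(`compactSpace_unitaryGroup_fin_three`).

Nothing here is a display; Mathlib only, no cell import. Header declaration (README §8(d)):
uses an L-value-free non-vanishing device: NO.
-/

open Matrix

namespace Summit.Ventures.HodgeRepro2.T5UnitaryGroupCompact

variable {n : Type*} [Fintype n] [DecidableEq n]

/-! ## 1. `U(n)` is closed -/

/-- `U(n) = {U | Uᴴ U = 1} ∩ {U | U Uᴴ = 1}` is closed in `Matrix n n ℂ`. -/
theorem isClosed_unitaryGroup : IsClosed (Matrix.unitaryGroup n ℂ : Set (Matrix n n ℂ)) := by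
  have h1 : IsClosed {U : Matrix n n ℂ | star U * U = 1} :=
    isClosed_eq (continuous_star.matrix_mul continuous_id) continuous_const
  have h2 : IsClosed {U : Matrix n n ℂ | U * star U = 1} :=
    isClosed_eq (continuous_id.matrix_mul continuous_star) continuous_const
  have hset : (Matrix.unitaryGroup n ℂ : Set (Matrix n n ℂ)) =
      {U | star U * U = 1} ∩ {U | U * star U = 1} := by
    ext U
    exact Unitary.mem_iff
  rw [hset]
  exact h1.inter h2

/-! ## 2. `U(n)` is bounded: the columns are unit vectors -/

/-- For `U ∈ U(n)`, `∑ᵢ ‖U i j‖² = 1` for every column `j` (the `(j, j)` entry of `Uᴴ U = 1`). -/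
theorem sum_norm_sq_col {U : Matrix n n ℂ} (hU : U ∈ Matrix.unitaryGroup n ℂ) (j : n) :
    ∑ i, ‖U i j‖ ^ 2 = 1 := by
  have h : star U * U = 1 := (Unitary.mem_iff.mp hU).1
  have hjj := congrFun (congrFun h j) j
  rw [Matrix.mul_apply, Matrix.one_apply_eq] at hjj
  have hjj' : ((∑ i, ‖U i j‖ ^ 2 : ℝ) : ℂ) = 1 := by
    rw [← hjj, Complex.ofReal_sum]
    refine Finset.sum_congr rfl fun i _ => ?_
    rw [Matrix.star_apply, Complex.star_def, ← Complex.normSq_eq_conj_mul_self,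
      Complex.normSq_eq_norm_sq]
  exact_mod_cast hjj'

/-- Every entry of a unitary matrix has norm at most `1`. -/
theorem norm_entry_le_one {U : Matrix n n ℂ} (hU : U ∈ Matrix.unitaryGroup n ℂ) (i j : n) :
    ‖U i j‖ ≤ 1 := by
  have hle : ‖U i j‖ ^ 2 ≤ 1 :=
    (sum_norm_sq_col hU j) ▸ Finset.single_le_sum (fun k _ => sq_nonneg ‖U k j‖) (Finset.mem_univ i)
  exact (sq_le_one_iff₀ (norm_nonneg _)).mp hle

/-! ## 3. `U(n)` is compact -/

/-- `U(n)` is a compact subset of `Matrix n n ℂ`: closed, and contained in the compact box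
`∏ᵢⱼ {z : ‖z‖ ≤ 1}` (Tychonoff). -/
theorem isCompact_unitaryGroup : IsCompact (Matrix.unitaryGroup n ℂ : Set (Matrix n n ℂ)) := by
  have hbox : IsCompact (Set.pi Set.univ fun _ : n => Set.pi Set.univ fun _ : n =>
      Metric.closedBall (0 : ℂ) 1 : Set (Matrix n n ℂ)) :=
    isCompact_univ_pi fun _ => isCompact_univ_pi fun _ => isCompact_closedBall 0 1
  refine hbox.of_isClosed_subset isClosed_unitaryGroup ?_
  intro U hU
  simp only [Set.mem_pi, Set.mem_univ, true_implies, Metric.mem_closedBall, dist_zero_right]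
  exact fun i j => norm_entry_le_one hU i j

/-- `U(n)` is a compact topological group (B1 Lemma B1.2.3). -/
instance compactSpace_unitaryGroup : CompactSpace (Matrix.unitaryGroup n ℂ) :=
  isCompact_iff_compactSpace.mp isCompact_unitaryGroup

/-- B1 l. 39: `U(3)` is compact. -/
theorem compactSpace_unitaryGroup_fin_three : CompactSpace (Matrix.unitaryGroup (Fin 3) ℂ) :=
  inferInstance

end Summit.Ventures.HodgeRepro2.T5UnitaryGroupCompact
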